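import Summits.SmoothPoincare4.SmoothPoincare4.Theorems.ConvexBisectionAcyclicBisectionExistsChartedChainPassagePrev
import Summits.SmoothPoincare4.SmoothPoincare4.Theorems.ConvexBisectionAcyclicBisectionExistsChartedChainCoreShadow
import Summits.SmoothPoincare4.SmoothPoincare4.Theorems.ConvexBisectionAcyclicBisectionExistsChartedChainExclusions
import Summits.SmoothPoincare4.SmoothPoincare4.Theorems.ConvexBisectionAcyclicBisectionExistsCrossingNumberShadow
import HarnessLib

/-!
# One clean descending passage: the crossing number of the charted vanishing cycle with the
# previous one is `−1`
(wave 4, brick Y4-4d of the model chain (R2) `exists_charted_chain` for the missing lemma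
`crossingNumber_eq_stdSymp` of node N1a of stub `stub_modelsOnFibred_of_reach` = NF4, line
`modp-braid-orbits`, crux `ConvexBisection.AcyclicBisectionExists`, item stmt-SmoothPoincare4-10508;
registered sub-goal `helper_crossingNumber_cycle_prev`)

`ψ = cycleChart` is the annulus chart of the vanishing cycle of `page g c` over `[ζ_{2g}, ζ_0]`
(core `b`), `baseRot g (2g) ∘ b = baseRot g (−1) ∘ b` the PREVIOUS vanishing cycle (over
`[ζ_{2g−1}, ζ_{2g}]`; shadow `chainVec g (2g−1)`), and `K` the previous passage loop of
`…ChartedChainPassagePrev.lean` (same shadow).  Then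

  **`crossingNumber ψ (baseRot g (2g) ∘ b) = crossingNumber ψ K = −1`** (`helper_crossingNumber_cycle_prev`)

— the sub-diagonal entry of the `A_{2g}` Gram matrix, obtained DIRECTLY (no symmetry statement):
on `(3/4, 7/8)` the loop is the radial line `u = 1/4` of the chart traversed downwards
(`passagePrev_eq`) and it is off the closed collar elsewhere (`passagePrev_off`, exclusions (X1)–(X3));
the REVERSED loop `K ∘ conj` (`reflS`) therefore makes one clean climbing passage
(`crossingNumber_single_passage`: `+1`), and reversal negates crossing numbers
(`crossingNumber_eq_neg_of_reverse`).
Everything is proved; no `sorry`.  References: B. Farb, D. Margalit, *A primer on mapping class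
groups* (2012), §6.1 [FarbMargalit2012]; W. Fulton, *Algebraic Topology* (1995), §3 [Fulton1995].
-/

noncomputable section

set_option linter.dupNamespace false

open scoped Manifold ContDiff Topology ComplexConjugate Real
open Set Function Metric Complex
open Literature.Topology.FourManifolds Literature.Topology.FourManifolds.LefschetzBase
  Literature.Topology.FourManifolds.TorusKnotMilnor

namespace Summit.SmoothPoincare4.SmoothPoincare4.Theorems.AcyclicBisectionExists.ModpBraidOrbits

variable {g : ℕ} {c : ℂ} {K : sphere (0 : EuclideanSpace ℝ (Fin 2)) 1 → Base g}

/-! ## §1 Where the previous passage loop is, relative to the chart -/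

/-- **Off the collar outside `(3/4, 7/8)`.** [folklore] -/
theorem passagePrev_off (hg : 1 ≤ g) (hc : ‖c‖ ≤ 1)
    (hKτ : ∀ τ ∈ Icc (0 : ℝ) 1, (K (circlePt τ)).1 = sheetAmb g c τ (passXP g τ)) {τ : ℝ}
    (hτ : τ ∈ Icc (0 : ℝ) (3 / 4) ∨ τ ∈ Icc (7 / 8 : ℝ) 1) :
    K (circlePt τ) ∉ cycleChart hg hc '' (univ ×ˢ Icc (-(1 / 2) : ℝ) (1 / 2)) := by
  have hτ01 : τ ∈ Icc (0 : ℝ) 1 := hτ.elim (fun h => ⟨h.1, by linarith [h.2]⟩) fun h => ⟨by linarith [h.1], h.2⟩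
  have hq := hKτ τ hτ01
  have hcx : cx (K (circlePt τ)).1 = scaleX g c * passXP g τ := by rw [hq, sheetAmb, cx_pagePt]
  have h34 : radP g (3 / 4) < radP g (1 / 2) :=
    strictAntiOn_radP g ⟨by norm_num, by norm_num⟩ ⟨by norm_num, by norm_num⟩ (by norm_num)
  have key : ∀ v ∈ Icc (0 : ℝ) (1 / 4), (gamP g v).re ≤ (jX g (I * radP g (-(3 / 4)))).re := by
    intro v hv
    rw [(gamP_pieces g v).1 hv, Complex.add_re, Complex.re_ofReal_mul, Complex.sub_re]
    have := re_branchPt_pred_le hg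
    nlinarith [hv.1, hv.2]
  by_cases hA : τ ≤ 1 / 8
  · -- upper straight segment
    refine not_mem_collar_of_re_le hg hc hcx ?_
    rw [(passXP_pieces g τ).1 ⟨hτ01.1, by linarith⟩]; exact key _ ⟨by linarith [hτ01.1], by linarith⟩
  by_cases hB : τ ≤ 1 / 4
  · -- upper real segment: not in the image of the chart at all
    have hv : 2 * τ ∈ Icc (1 / 4 : ℝ) (1 / 2) := ⟨by linarith [not_le.1 hA], by linarith⟩
    rintro ⟨p, -, hp⟩
    refine not_mem_image_of_upper hg hc (one_lt_radP g (6 * (2 * τ) - 9 / 4)).le (radP_le' g _) ?_ p hp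
    rw [hq, sheetAmb, halfSign, if_pos (by linarith), one_mul, (passXP_pieces g τ).1 ⟨hτ01.1, by linarith⟩,
      (gamP_pieces g _).2.1 hv]
  by_cases hC : τ ≤ 3 / 8
  · -- upper return segment
    have hv : 2 * τ ∈ Icc (1 / 2 : ℝ) (3 / 4) := ⟨by linarith [not_le.1 hB], by linarith⟩
    rw [(passXP_pieces g τ).1 ⟨hτ01.1, by linarith⟩, (gamP_pieces g _).2.2.1 hv] at hcx
    have hn : ‖I * (rhoBP g (2 * τ) : ℂ)‖ = rhoBP g (2 * τ) := by
      rw [norm_mul, Complex.norm_I, one_mul, Complex.norm_real, Real.norm_eq_abs, abs_of_pos (by linarith [(rhoBP_mem g hv).1])]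
    exact not_mem_collar_of_norm_lt hg hc hcx (by rw [hn]; exact (rhoBP_mem g hv).1)
      (by rw [hn]; exact lt_of_le_of_lt (rhoBP_mem g hv).2 h34)
  by_cases hD : τ ≤ 1 / 2
  · -- upper chord
    have hv : 2 * τ ∈ Icc (3 / 4 : ℝ) 1 := ⟨by linarith [not_le.1 hC], by linarith⟩
    rw [(passXP_pieces g τ).1 ⟨hτ01.1, hD⟩, (gamP_pieces g _).2.2.2 hv] at hcx
    exact not_mem_collar_of_norm_lt hg hc hcx (by rw [Complex.norm_exp_ofReal_mul_I])
      (by rw [Complex.norm_exp_ofReal_mul_I]; exact one_lt_radP g _)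
  by_cases hE : τ ≤ 5 / 8
  · -- lower chord
    have hv : 2 - 2 * τ ∈ Icc (3 / 4 : ℝ) 1 := ⟨by linarith, by linarith [not_le.1 hD]⟩
    rw [(passXP_pieces g τ).2 ⟨(not_le.1 hD).le, hτ01.2⟩, (gamP_pieces g _).2.2.2 hv] at hcx
    exact not_mem_collar_of_norm_lt hg hc hcx (by rw [Complex.norm_exp_ofReal_mul_I])
      (by rw [Complex.norm_exp_ofReal_mul_I]; exact one_lt_radP g _)
  by_cases hF : τ ≤ 3 / 4
  · -- lower return segment
    have hv : 2 - 2 * τ ∈ Icc (1 / 2 : ℝ) (3 / 4) := ⟨by linarith, by linarith [not_le.1 hE]⟩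
    rw [(passXP_pieces g τ).2 ⟨by linarith, hτ01.2⟩, (gamP_pieces g _).2.2.1 hv] at hcx
    have hn : ‖I * (rhoBP g (2 - 2 * τ) : ℂ)‖ = rhoBP g (2 - 2 * τ) := by
      rw [norm_mul, Complex.norm_I, one_mul, Complex.norm_real, Real.norm_eq_abs, abs_of_pos (by linarith [(rhoBP_mem g hv).1])]
    exact not_mem_collar_of_norm_lt hg hc hcx (by rw [hn]; exact (rhoBP_mem g hv).1)
      (by rw [hn]; exact lt_of_le_of_lt (rhoBP_mem g hv).2 h34)
  · -- lower straight segment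
    have hτ' : τ ∈ Icc (7 / 8 : ℝ) 1 := hτ.elim (fun h => absurd h.2 hF) id
    refine not_mem_collar_of_re_le hg hc hcx ?_
    rw [(passXP_pieces g τ).2 ⟨by linarith [hτ'.1], hτ01.2⟩]
    exact key _ ⟨by linarith [hτ01.2], by linarith [hτ'.1]⟩

/-- **On `[3/4, 7/8]` the previous passage loop is the radial line `u = 1/4` of the chart at
height `39/4 − 12τ`** (descending). [folklore] -/
theorem passagePrev_eq (hg : 1 ≤ g) (hc : ‖c‖ ≤ 1)
    (hKτ : ∀ τ ∈ Icc (0 : ℝ) 1, (K (circlePt τ)).1 = sheetAmb g c τ (passXP g τ)) {τ : ℝ}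
    (hτ : τ ∈ Icc (3 / 4 : ℝ) (7 / 8)) :
    K (circlePt τ) = cycleChart hg hc (1 / 4, 39 / 4 - 12 * τ) := by
  apply Subtype.ext
  have hv : 2 - 2 * τ ∈ Icc (1 / 4 : ℝ) (1 / 2) := ⟨by linarith [hτ.2], by linarith [hτ.1]⟩
  rw [hKτ τ ⟨by linarith [hτ.1], by linarith [hτ.2]⟩, sheetAmb, halfSign, if_neg (by linarith [hτ.1]),
    (passXP_pieces g τ).2 ⟨by linarith [hτ.1], by linarith [hτ.2]⟩, (gamP_pieces g _).2.1 hv,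
    show (6 * (2 - 2 * τ) - 9 / 4 : ℝ) = 39 / 4 - 12 * τ by ring, cycleChart_val, cycleAmb, tParam_quarter,
    jY_I_mul_eq_neg_csqrt hg (one_lt_radP g _).le (radP_le' g _), neg_one_mul]

/-! ## §2 Reversal -/

/-- Complex conjugation of the plane `ℝ²`. [folklore] -/
def reflE (v : EuclideanSpace ℝ (Fin 2)) : EuclideanSpace ℝ (Fin 2) := WithLp.toLp 2 ![v 0, -v 1]

/-- The reflection is continuous. [folklore] -/
theorem continuous_reflE : Continuous reflE := by
  unfold reflE
  refine (EuclideanSpace.equiv (Fin 2) ℝ).symm.continuous.comp (continuous_pi fun i => ?_)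
  fin_cases i
  · exact (EuclideanSpace.proj (0 : Fin 2)).continuous
  · exact (EuclideanSpace.proj (1 : Fin 2)).continuous.neg

/-- The reflection preserves the norm. [folklore] -/
theorem norm_reflE (v : EuclideanSpace ℝ (Fin 2)) : ‖reflE v‖ = ‖v‖ := by
  simp [reflE, EuclideanSpace.norm_eq, Fin.sum_univ_two]

/-- **The reflection of the circle**, `e^{2πit} ↦ e^{−2πit}`. [folklore] -/
def reflS (θ : sphere (0 : EuclideanSpace ℝ (Fin 2)) 1) : sphere (0 : EuclideanSpace ℝ (Fin 2)) 1 :=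
  ⟨reflE θ.1, by rw [mem_sphere_zero_iff_norm, norm_reflE, ← mem_sphere_zero_iff_norm]; exact θ.2⟩

/-- `reflS (e^{2πit}) = e^{−2πit}`. [folklore] -/
theorem reflS_circlePt (t : ℝ) : reflS (circlePt t) = circlePt (-t) := by
  apply Subtype.ext
  show reflE (circlePt t).1 = (circlePt (-t)).1
  rw [circlePt_eq_circlePoint, circlePt_eq_circlePoint]
  ext i
  fin_cases i <;> simp [reflE, circlePoint, mul_neg, Real.cos_neg, Real.sin_neg]

/-- The reflection of the circle is continuous. [folklore] -/
theorem continuous_reflS : Continuous reflS :=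
  Continuous.subtype_mk (continuous_reflE.comp continuous_subtype_val) _

/-! ## §3 The crossing numbers -/

/-- **The previous passage loop crosses the chart once, descending: `crossingNumber ψ K = −1`.**
[cite: Fulton1995, §3] -/
theorem crossingNumber_passageLoopPrev (hg : 1 ≤ g) (hc : ‖c‖ = 1) (hK : Continuous K) (hKp : ∀ θ, K θ ∈ page g c)
    (hKτ : ∀ τ ∈ Icc (0 : ℝ) 1, (K (circlePt τ)).1 = sheetAmb g c τ (passXP g τ)) :
    crossingNumber (cycleChart hg hc.le) K = -1 := by
  have hψ1 := cycleChart_periodic hg hc.le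
  have hψi := cycleChart_injOn hg hc.le
  have hψc := continuous_cycleChart hg hc.le
  have hψp := cycleChart_mem_page hg hc.le
  -- the reversed loop
  have hR : Continuous (K ∘ reflS) := hK.comp continuous_reflS
  have hRp : ∀ θ, (K ∘ reflS) θ ∈ page g c := fun θ => hKp _
  have hRt : ∀ t : ℝ, (K ∘ reflS) (circlePt t) = K (circlePt (-t)) := fun t => by rw [comp_apply, reflS_circlePt]
  have hRt' : ∀ t : ℝ, (K ∘ reflS) (circlePt t) = K (circlePt (1 - t)) := fun t => by
    rw [hRt, show (1 - t) = -t + 1 by ring, circlePt_add_one]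
  have hrev := crossingNumber_eq_neg_of_reverse hc hψc hψ1 hψp hψi hK hKp hR hRp hRt
  -- the reversed loop climbs once
  have hr : ∀ τ ∈ Icc (1 / 8 : ℝ) (1 / 4), 12 * τ - 9 / 4 ∈ Ioo (-1 : ℝ) 1 := fun τ hτ =>
    ⟨by linarith [hτ.1], by linarith [hτ.2]⟩
  have heq : ∀ τ ∈ Icc (1 / 8 : ℝ) (1 / 4), (K ∘ reflS) (circlePt τ) = cycleChart hg hc.le (1 / 4, 12 * τ - 9 / 4) := by
    intro τ hτ
    rw [hRt', passagePrev_eq hg hc.le hKτ ⟨by linarith [hτ.2], by linarith [hτ.1]⟩]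
    congr 2; ring
  have hone : crossingNumber (cycleChart hg hc.le) (K ∘ reflS) = 1 := by
    refine crossingNumber_single_passage hc hψc hψ1 hψp hψi hR hRp (s := 1 / 8) (t := 1 / 4) (by norm_num) (by norm_num)
      (by norm_num) ?_ ?_ ?_ ?_ ?_
    · intro τ hτ
      exact ⟨(1 / 4, 12 * τ - 9 / 4), ⟨trivial, hr τ hτ⟩, (heq τ hτ).symm⟩
    · intro τ hτ
      rw [hRt']; exact passagePrev_off hg hc.le hKτ (Or.inr ⟨by linarith [hτ.2], by linarith [hτ.1]⟩)
    · intro τ hτ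
      rw [hRt']; exact passagePrev_off hg hc.le hKτ (Or.inl ⟨by linarith [hτ.2], by linarith [hτ.1]⟩)
    · rw [heq _ ⟨le_rfl, by norm_num⟩, height_of_lift hψ1 hψi (by norm_num)]; norm_num
    · rw [heq _ ⟨by norm_num, le_rfl⟩, height_of_lift hψ1 hψi (by norm_num)]; norm_num
  rw [hone] at hrev
  linarith

/-- **Sub-goal `helper_crossingNumber_cycle_prev`** (Y4-4d of the model chain (R2) for node N1a of
NF4): the annulus chart `cycleChart` of the vanishing cycle of `page g c` over `[ζ_{2g}, ζ_0]`
(core `b`) crosses the PREVIOUS vanishing cycle `baseRot g (2g) ∘ b` (over `[ζ_{2g−1}, ζ_{2g}]`) with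
crossing number `−1` (`g ≥ 1`, `‖c‖ = 1`). [cite: FarbMargalit2012, §6.1] -/
theorem helper_crossingNumber_cycle_prev : ∀ (g : ℕ) (c : ℂ) (hg : 1 ≤ g) (hc : ‖c‖ = 1) (b : Metric.sphere (0 : EuclideanSpace ℝ (Fin 2)) 1 → Literature.Topology.FourManifolds.LefschetzBase.Base g), (∀ u : ℝ, Summit.SmoothPoincare4.SmoothPoincare4.Theorems.AcyclicBisectionExists.ModpBraidOrbits.cycleChart hg hc.le (u, 0) = b (Literature.Topology.FourManifolds.circlePt u)) → Summit.SmoothPoincare4.SmoothPoincare4.Theorems.AcyclicBisectionExists.ModpBraidOrbits.crossingNumber (Summit.SmoothPoincare4.SmoothPoincare4.Theorems.AcyclicBisectionExists.ModpBraidOrbits.cycleChart hg hc.le) (Summit.SmoothPoincare4.SmoothPoincare4.Theorems.AcyclicBisectionExists.ModpBraidOrbits.baseRot g (2 * g) ∘ b) = -1 := by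
  intro g c hg hc b hbu
  have hc' : ‖c‖ ≤ 1 := hc.le
  obtain ⟨K, hK, hKp, hKτ, hKs⟩ := helper_passageLoopPrev g c hg hc'
  have hb : Continuous b := by
    obtain ⟨b', hb', hb'u⟩ := exists_cycleCore hg hc'
    have e : b = b' := by
      funext θ
      obtain ⟨τ, -, rfl⟩ := exists_Icc_circlePt_eq θ
      rw [← hbu, hb'u]
    rw [e]; exact hb'
  have hb1 : Continuous (baseRot g (2 * g) ∘ b) := (continuous_baseRot g _).comp hb
  have hbp : ∀ θ, (baseRot g (2 * g) ∘ b) θ ∈ page g c := fun θ => by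
    obtain ⟨τ, -, rfl⟩ := exists_Icc_circlePt_eq θ
    rw [comp_apply, baseRot_mem_page_iff, ← hbu]
    exact cycleChart_mem_page hg hc' _
  have hsh : shadow g (baseRot g (2 * g) ∘ b) hb1 = shadow g K hK := by
    rw [hKs]
    have h := helper_shadow_baseRot_cycleCore g c hg hc' b hbu (2 * g - 1) (by omega)
    rw [show 2 * g - 1 + 1 = 2 * g by omega] at h
    exact h hb1
  rw [crossingNumber_eq_of_shadow_eq hc (continuous_cycleChart hg hc') (cycleChart_periodic hg hc')
    (cycleChart_mem_page hg hc') (cycleChart_injOn hg hc') hb1 hbp hK hKp hsh]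
  exact crossingNumber_passageLoopPrev hg hc hK hKp hKτ

end Summit.SmoothPoincare4.SmoothPoincare4.Theorems.AcyclicBisectionExists.ModpBraidOrbits

end
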